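import Literature.Geometry.Symplectic.SymplecticTraceHessianIntegral
import Literature.Geometry.GaugeTheory.AdaptedFramesDivergence
import HarnessLib

/-!
# The divergence theorem `∫_N (div θ) ω ∧ ω = 0` on a closed symplectic `4`-manifold

Topic `Literature/Geometry/Symplectic`; generalises `SymplecticTraceHessianIntegral` (`θ = df`,
`∫ Δf ω² = 0`) to arbitrary smooth real 1-forms: for `θ` smooth on the closed symplectic `4`-manifold
`(N, s, J)` with its compatible metric `g_J`, the frame divergence
`div θ = Σ_k (∇_{e_k}θ)(e_k) = Σ_k (e_k(θ(e_k)) - θ(∇_{e_k}e_k))` in the unitary frames of `𝔰_J`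
integrates to zero against the volume form `s ∧ s`:

  `∫_N (Σ_k (∇_{e_k}θ)(e_k)) · (s ∧ s) = 0`

— the integration by parts used for the formal adjoints of `d`, `∇_A`, `D_A` in Taubes 1994, §§2–3
("After an integration by parts ..."). Proof: `div θ = -(d(θ∘J)(e₀,e₁) + d(θ∘J)(e₂,e₃))`
(`AdaptedFrames.mextDeriv_jPrecomp_frame_sum`, the quasi-Kähler cancellation) and
`θ' ∧ s = ½(θ'(e₀,e₁) + θ'(e₂,e₃))(s ∧ s)`, so the integrand is `-2 d(θ∘J) ∧ s`, exact.

* `divergence h hs hnd θ x = Σ_k (∇_{e_k}θ)(e_k)(x)` in the unitary frame of the chart at `x`;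
* **`integral_divergence_smul_wedge_self_eq_zero`**.

PROVED, 0 named facts.

## References

* C. H. Taubes, *The Seiberg–Witten invariants and symplectic forms*, Math. Res. Lett. 1 (1994)
  809–822, §3 (21)–(22) (p. 817). [Taubes1994]
* F. W. Warner, *Foundations of Differentiable Manifolds and Lie Groups*, GTM 94 (1983), 4.9, 6.1–6.2.
  [WarnerGTM94]
-/

noncomputable section

open scoped Manifold ContDiff Topology
open Set Function Complex Literature.Geometry.Kaehler Literature.Geometry.GaugeTheory Literature.Topology.FourManifolds
open Literature.Geometry.Lorentzian (PseudoRiemannianMetric)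
open Literature.Geometry.Manifold Literature.Geometry.Manifold.DeRhamSignFour Literature.NumberTheory.Transcendental

namespace Literature.Geometry.Symplectic

namespace AlmostComplexStructure.IsCompatibleWith

variable {N : Type} [TopologicalSpace N] [ChartedSpace (EuclideanSpace ℝ (Fin 4)) N] [IsManifold (𝓡 4) ∞ N]
  {J : AlmostComplexStructure (𝓡 4) ∞ N} {s : MForm (𝓡 4) N ℝ 2}
  (h : J.IsCompatibleWith s) (hs : IsSmoothForm s)
  (hnd : ∀ x (v : TangentSpace (𝓡 4) x), v ≠ 0 → ∃ w : TangentSpace (𝓡 4) x, s x ![v, w] ≠ 0)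
  [(h.metric hs).HasLeviCivita]

/-- **The divergence `Σ_k (∇_{e_k}θ)(e_k)(x)` of a real 1-form w.r.t. `g_J`**, in the unitary frame of the
chart of `𝔰_J` at `x` (`= -δθ`). [cite: WarnerGTM94, 6.1] -/
def divergence (θ : RealOneForm N) (x : N) : ℝ :=
  (h.unitaryAdaptedFrames hs hnd).frameDivergence θ ((h.canonicalSpincStructure hs hnd).indexAt x) x

/-- Unfolding `divergence`. [folklore] -/
theorem divergence_apply (θ : RealOneForm N) (x : N) :
    h.divergence hs hnd θ x = ∑ k, (mvfderiv (𝓡 4) (fun y ↦ θ y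
        ((h.canonicalSpincStructure hs hnd).frame ((h.canonicalSpincStructure hs hnd).indexAt x) k y)) x
        ((h.canonicalSpincStructure hs hnd).frame ((h.canonicalSpincStructure hs hnd).indexAt x) k x) -
      θ x ((h.metric hs).leviCivita ((h.canonicalSpincStructure hs hnd).frame ((h.canonicalSpincStructure hs hnd).indexAt x) k) x
        ((h.canonicalSpincStructure hs hnd).frame ((h.canonicalSpincStructure hs hnd).indexAt x) k x))) :=
  rfl

/-- The divergence of `df` is the trace of the Hessian. [cite: ONeill1983, Ch. 3, Def. 3.48] -/
theorem divergence_mvfderiv (f : N → ℝ) : h.divergence hs hnd (fun y ↦ mvfderiv (𝓡 4) f y) = h.traceHessian hs hnd f :=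
  rfl

/-- **The divergence is the `ω`-component of `d(θ ∘ J)`** on `(N, s, J)` with `ds = 0`, in the unitary
frame at `x`: `d(θ∘J)(e₀,e₁) + d(θ∘J)(e₂,e₃) = -div θ (x)` (`AdaptedFrames.mextDeriv_jPrecomp_frame_sum`).
[cite: Taubes1994, §3 (21) (p. 817)] -/
theorem mextDeriv_jPrecomp_frame_sum_eq (hcl : IsClosedForm s) {θ : RealOneForm N} (hθ : IsSmoothForm θ.toMForm) (x : N) :
    mextDeriv (jPrecomp J θ).toMForm x
        ![(h.canonicalSpincStructure hs hnd).frame ((h.canonicalSpincStructure hs hnd).indexAt x) 0 x,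
          (h.canonicalSpincStructure hs hnd).frame ((h.canonicalSpincStructure hs hnd).indexAt x) 1 x] +
      mextDeriv (jPrecomp J θ).toMForm x
        ![(h.canonicalSpincStructure hs hnd).frame ((h.canonicalSpincStructure hs hnd).indexAt x) 2 x,
          (h.canonicalSpincStructure hs hnd).frame ((h.canonicalSpincStructure hs hnd).indexAt x) 3 x] =
      -h.divergence hs hnd θ x :=
  (h.unitaryAdaptedFrames hs hnd).mextDeriv_jPrecomp_frame_sum ((h.canonicalSpincStructure hs hnd).indexAt x)
    ((h.canonicalSpincStructure hs hnd).mem_baseSet_indexAt x) s hs hcl (fun y _ v w ↦ h.form_eq_metric_val_map hs y v w)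
    fun y _ ↦ hθ y

/-- **The divergence theorem `∫_N (Σ_k (∇_{e_k}θ)(e_k)) (s ∧ s) = 0`** for a smooth real 1-form `θ` on
the closed symplectic `4`-manifold `(N, s, J)`: the integrand is `-2 d(θ∘J) ∧ s`, exact.
[cite: Taubes1994, §3 (21)–(22) (p. 817)] [cite: WarnerGTM94, 4.9] -/
theorem integral_divergence_smul_wedge_self_eq_zero [T2Space N] [CompactSpace N] (hcl : IsClosedForm s)
    {θ : RealOneForm N} (hθ : IsSmoothForm θ.toMForm) :
    MForm.integral (rayFamily (wedge_self_castDeg_apply_ne_zero s hnd))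
      ((h.divergence hs hnd θ) • (s.wedge s).castDeg two_add_two_eq_four) = 0 := by
  have hint := integral_mextDeriv_toMForm_wedge_eq_zero hs hnd hcl (θ := jPrecomp J θ) fun x ↦ smoothAt_jPrecomp J (hθ x)
  have hθ' := h.wedge_symplectic_eq_smul_wedge_self hs hnd (mextDeriv (jPrecomp J θ).toMForm)
  have hcoef : (fun x ↦ (mextDeriv (jPrecomp J θ).toMForm x
        ![(h.canonicalSpincStructure hs hnd).frame ((h.canonicalSpincStructure hs hnd).indexAt x) 0 x,
          (h.canonicalSpincStructure hs hnd).frame ((h.canonicalSpincStructure hs hnd).indexAt x) 1 x] +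
      mextDeriv (jPrecomp J θ).toMForm x
        ![(h.canonicalSpincStructure hs hnd).frame ((h.canonicalSpincStructure hs hnd).indexAt x) 2 x,
          (h.canonicalSpincStructure hs hnd).frame ((h.canonicalSpincStructure hs hnd).indexAt x) 3 x]) / 2) =
      fun x ↦ (-2⁻¹ : ℝ) * h.divergence hs hnd θ x := by
    funext x
    rw [h.mextDeriv_jPrecomp_frame_sum_eq hs hnd hcl hθ x]
    ring
  rw [hθ', hcoef] at hint
  have hsmul : ((fun x ↦ (-2⁻¹ : ℝ) * h.divergence hs hnd θ x) • s.wedge s).castDeg two_add_two_eq_four =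
      (-2⁻¹ : ℝ) • ((h.divergence hs hnd θ) • (s.wedge s).castDeg two_add_two_eq_four) := by
    funext x
    ext w
    simp [mul_assoc]
  rw [hsmul, MForm.integral_smul] at hint
  simpa using hint

end AlmostComplexStructure.IsCompatibleWith

end Literature.Geometry.Symplectic

end
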